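import Literature.NumberTheory.GaloisRepresentations.ContinuousRep

/-!
# Route `DedekindQuotient1951` (Langlands) — support `DoudMoorePermutationSupply`: the hyperplane block

Generic linear algebra behind "permutation representation = trivial ⊕ standard":
for a square matrix `M` of size `n + 1` whose **columns all sum to `1`** (e.g. a permutation
matrix) the sum-zero hyperplane `V₀ = {x | ∑ xᵢ = 0}` is stable, and in the basis
`e₁ - e₀, …, eₙ - e₀` of `V₀` the restriction of `M` has matrix
`H(M) = (M (j+1) (k+1) - M (j+1) 0)ⱼₖ` (written out as `Matrix.of fun j k => …` throughout; no
definition is introduced).  We prove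

* `hypMat_one`, `hypMat_mul` — `H` is multiplicative on matrices with unit column sums;
* `charpoly_eq_X_sub_one_mul_charpoly_hypMat` — `det(X - M) = (X - 1) · det(X - H(M))` (row and
  column operations by unipotent matrices, then Laplace expansion along the first row);
* `mulVec_cons_neg_sum` — `M (ũ) = (H(M) u)˜` for the lift `ũ = (-∑ u, u)` of `u ∈ Aⁿ` to `V₀`;
* `mulVec_of_perm`, `sum_of_perm` — permutation matrices act by `x ↦ x ∘ p⁻¹` and have unit
  column sums;
* `exists_hyperplaneRep` — for a framed continuous representation `Π : G →ₜ* GL_{n+1}(A)` all of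
  whose matrices have unit column sums, a framed continuous representation `g ↦ H(Π g)` of rank
  `n` (so that `(X - 1) · charpoly = charpoly Π` by the third item).

References: J.-P. Serre, *Linear representations of finite groups*, GTM 42, §2.3 Exercise 2.6
(permutation representation = `1 ⊕ standard`); folklore linear algebra.
-/

set_option linter.dupNamespace false

noncomputable section

open Polynomial Matrix

namespace Summit.Langlands.Langlands.Theorems.DedekindQuotient1951

universe u v

section Hyp

variable {R : Type u} [CommRing R] {n : ℕ}

/-- The hyperplane block of the identity matrix is the identity. [folklore] -/
theorem hypMat_one :
    (Matrix.of fun j k : Fin n => (1 : Matrix (Fin (n + 1)) (Fin (n + 1)) R) j.succ k.succ -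
      (1 : Matrix (Fin (n + 1)) (Fin (n + 1)) R) j.succ 0) = 1 := by
  ext j k
  rw [Matrix.of_apply, Matrix.one_apply, Matrix.one_apply, Matrix.one_apply,
    if_neg (Fin.succ_ne_zero j), sub_zero]
  simp only [Fin.succ_inj]

/-- The hyperplane block is multiplicative as soon as the right factor has unit column sums
(then it preserves the sum-zero hyperplane). [folklore] -/
theorem hypMat_mul (M N : Matrix (Fin (n + 1)) (Fin (n + 1)) R) (hN : ∀ k, ∑ j, N j k = 1) :
    (Matrix.of fun j k : Fin n => (M * N) j.succ k.succ - (M * N) j.succ 0) =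
      (Matrix.of fun j k : Fin n => M j.succ k.succ - M j.succ 0) *
        (Matrix.of fun j k : Fin n => N j.succ k.succ - N j.succ 0) := by
  ext j k
  have h1 := hN k.succ
  have h0 := hN 0
  rw [Fin.sum_univ_succ] at h1 h0
  simp only [Matrix.of_apply, Matrix.mul_apply, Fin.sum_univ_succ, sub_mul, mul_sub,
    Finset.sum_sub_distrib, ← Finset.mul_sum]
  linear_combination (M j.succ 0) * (h1 - h0)

/-- Column sums of the characteristic matrix of a matrix with unit column sums are `X - 1`.
[folklore] -/
theorem sum_charmatrix (M : Matrix (Fin (n + 1)) (Fin (n + 1)) R) (hM : ∀ k, ∑ j, M j k = 1)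
    (k : Fin (n + 1)) : ∑ l, M.charmatrix l k = X - 1 := by
  simp only [Matrix.charmatrix_apply, Finset.sum_sub_distrib, Matrix.diagonal_apply]
  rw [Finset.sum_ite_eq' Finset.univ k (fun _ => (X : R[X])), if_pos (Finset.mem_univ k),
    ← map_sum, hM k, map_one]

/-- **`det(X - M) = (X - 1) · det(X - H(M))`** for a square matrix `M` with unit column sums and
its hyperplane block `H(M) = (M (j+1) (k+1) - M (j+1) 0)ⱼₖ`: with the unipotent matrices `Q` (first
row all ones) and `P` (columns `e₀, e₁ - e₀, …, eₙ - e₀`), `Q · (X - M) · P` has first row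
`(X - 1, 0, …, 0)` and lower-right block `X - H(M)`. [folklore] -/
theorem charpoly_eq_X_sub_one_mul_charpoly_hypMat (M : Matrix (Fin (n + 1)) (Fin (n + 1)) R)
    (hM : ∀ k, ∑ j, M j k = 1) :
    M.charpoly = (X - 1) * (Matrix.of fun j k : Fin n => M j.succ k.succ - M j.succ 0).charpoly := by
  -- the unipotent matrices
  set P : Matrix (Fin (n + 1)) (Fin (n + 1)) R[X] := Matrix.of
    (Fin.cases (Fin.cases 1 fun _ => -1) fun l => Fin.cases 0 fun k => if l = k then 1 else 0) with hP
  set Q : Matrix (Fin (n + 1)) (Fin (n + 1)) R[X] := Matrix.of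
    (Fin.cases (fun _ => 1) fun j => Fin.cases 0 fun l => if j = l then 1 else 0) with hQ
  have hP00 : P 0 0 = 1 := by simp [hP]
  have hP0s : ∀ k : Fin n, P 0 k.succ = -1 := fun k => by simp [hP]
  have hPs0 : ∀ l : Fin n, P l.succ 0 = 0 := fun l => by simp [hP]
  have hPss : ∀ l k : Fin n, P l.succ k.succ = if l = k then 1 else 0 := fun l k => by simp [hP]
  have hQ0 : ∀ l : Fin (n + 1), Q 0 l = 1 := fun l => by simp [hQ]
  have hQs0 : ∀ j : Fin n, Q j.succ 0 = 0 := fun j => by simp [hQ]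
  have hQss : ∀ j l : Fin n, Q j.succ l.succ = if j = l then 1 else 0 := fun j l => by simp [hQ]
  -- right multiplication by `P`: column `0` unchanged, subtracted from the other columns
  have hmulP0 : ∀ (S : Matrix (Fin (n + 1)) (Fin (n + 1)) R[X]) (i : Fin (n + 1)),
      (S * P) i 0 = S i 0 := fun S i => by
    rw [Matrix.mul_apply, Fin.sum_univ_succ, hP00, mul_one]
    simp only [hPs0, mul_zero, Finset.sum_const_zero, add_zero]
  have hmulPs : ∀ (S : Matrix (Fin (n + 1)) (Fin (n + 1)) R[X]) (i : Fin (n + 1)) (k : Fin n),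
      (S * P) i k.succ = S i k.succ - S i 0 := fun S i k => by
    rw [Matrix.mul_apply, Fin.sum_univ_succ, hP0s, mul_neg, mul_one]
    simp only [hPss, mul_ite, mul_one, mul_zero, Finset.sum_ite_eq', Finset.mem_univ, if_true]
    ring
  -- left multiplication by `Q`: row `0` becomes the sum of all rows, the others are unchanged
  have hQmul0 : ∀ (T : Matrix (Fin (n + 1)) (Fin (n + 1)) R[X]) (k : Fin (n + 1)),
      (Q * T) 0 k = ∑ l, T l k := fun T k => by
    rw [Matrix.mul_apply]
    exact Finset.sum_congr rfl fun l _ => by rw [hQ0, one_mul]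
  have hQmuls : ∀ (T : Matrix (Fin (n + 1)) (Fin (n + 1)) R[X]) (j : Fin n) (k : Fin (n + 1)),
      (Q * T) j.succ k = T j.succ k := fun T j k => by
    rw [Matrix.mul_apply, Fin.sum_univ_succ, hQs0, zero_mul, zero_add]
    simp only [hQss, ite_mul, one_mul, zero_mul, Finset.sum_ite_eq, Finset.mem_univ, if_true]
  -- both are upper unitriangular
  have hdetP : P.det = 1 := by
    rw [Matrix.det_of_upperTriangular]
    · rw [Fin.prod_univ_succ, hP00, one_mul]
      exact Finset.prod_eq_one fun l _ => by rw [hPss, if_pos rfl]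
    · intro i j hij
      induction i using Fin.cases with
      | zero => exact absurd hij (Fin.not_lt_zero _)
      | succ l =>
        induction j using Fin.cases with
        | zero => exact hPs0 l
        | succ k =>
          rw [hPss, if_neg]
          rintro rfl
          exact lt_irrefl _ hij
  have hdetQ : Q.det = 1 := by
    rw [Matrix.det_of_upperTriangular]
    · rw [Fin.prod_univ_succ, hQ0, one_mul]
      exact Finset.prod_eq_one fun l _ => by rw [hQss, if_pos rfl]
    · intro i j hij
      induction i using Fin.cases with
      | zero => exact absurd hij (Fin.not_lt_zero _)
      | succ l =>
        induction j using Fin.cases with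
        | zero => exact hQs0 l
        | succ k =>
          rw [hQss, if_neg]
          rintro rfl
          exact lt_irrefl _ hij
  -- `U = Q (X - M) P`
  set U := Q * M.charmatrix * P with hU
  have hdet : U.det = M.charpoly := by
    rw [hU, Matrix.det_mul, Matrix.det_mul, hdetQ, hdetP, one_mul, mul_one, Matrix.charpoly]
  have h00 : U 0 0 = X - 1 := by
    rw [hU, hmulP0, hQmul0, sum_charmatrix M hM]
  have h0s : ∀ k : Fin n, U 0 k.succ = 0 := fun k => by
    rw [hU, hmulPs, hQmul0, hQmul0, sum_charmatrix M hM, sum_charmatrix M hM, sub_self]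
  have hss : U.submatrix Fin.succ Fin.succ =
      (Matrix.of fun j k : Fin n => M j.succ k.succ - M j.succ 0).charmatrix := by
    refine Matrix.ext fun j k => ?_
    rw [Matrix.submatrix_apply, hU, hmulPs, hQmuls, hQmuls, Matrix.charmatrix_apply,
      Matrix.charmatrix_apply, Matrix.charmatrix_apply, Matrix.of_apply, Matrix.diagonal_apply,
      Matrix.diagonal_apply, Matrix.diagonal_apply, if_neg (Fin.succ_ne_zero j), map_sub]
    simp only [Fin.succ_inj]
    ring
  rw [← hdet, Matrix.det_succ_row_zero, Fin.sum_univ_succ, Fin.succAbove_zero, hss, h00,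
    Matrix.charpoly]
  simp only [h0s, mul_zero, zero_mul, Finset.sum_const_zero, add_zero, Fin.val_zero, pow_zero,
    one_mul]

/-- **The lift `ũ = (-∑ u, u)` of `u ∈ Rⁿ` to the sum-zero hyperplane intertwines `H(M)` and `M`**:
`M ũ = (H(M) u)˜` for a square matrix `M` with unit column sums. [folklore] -/
theorem mulVec_cons_neg_sum (M : Matrix (Fin (n + 1)) (Fin (n + 1)) R) (hM : ∀ k, ∑ j, M j k = 1)
    (u : Fin n → R) :
    M *ᵥ (Fin.cons (-∑ k, u k) u : Fin (n + 1) → R) =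
      Fin.cons (-∑ j, ((Matrix.of fun j k : Fin n => M j.succ k.succ - M j.succ 0) *ᵥ u) j)
        ((Matrix.of fun j k : Fin n => M j.succ k.succ - M j.succ 0) *ᵥ u) := by
  have hcol : ∀ k : Fin (n + 1), ∑ j : Fin n, M j.succ k = 1 - M 0 k := fun k => by
    have h := hM k
    rw [Fin.sum_univ_succ] at h
    linear_combination h
  funext i
  induction i using Fin.cases with
  | zero =>
    rw [Fin.cons_zero, Matrix.mulVec, dotProduct, Fin.sum_univ_succ, Fin.cons_zero]
    simp only [Fin.cons_succ, Matrix.mulVec, dotProduct, Matrix.of_apply, sub_mul,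
      Finset.sum_sub_distrib]
    rw [Finset.sum_comm]
    simp only [← Finset.sum_mul, ← Finset.mul_sum, hcol]
    simp only [sub_mul, one_mul, Finset.sum_sub_distrib]
    ring
  | succ j =>
    rw [Fin.cons_succ, Matrix.mulVec, dotProduct, Fin.sum_univ_succ, Fin.cons_zero]
    simp only [Fin.cons_succ, Matrix.mulVec, dotProduct, Matrix.of_apply, sub_mul,
      Finset.sum_sub_distrib, mul_neg, Finset.mul_sum]
    ring

/-- **A permutation matrix acts by `x ↦ x ∘ p⁻¹`**: if `M i j = [p j = i]` then
`(M x) i = x (p⁻¹ i)`. [folklore] -/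
theorem mulVec_of_perm {m : ℕ} (p : Equiv.Perm (Fin m)) (M : Matrix (Fin m) (Fin m) R)
    (hM : ∀ i j, M i j = if p j = i then 1 else 0) (x : Fin m → R) :
    M *ᵥ x = fun i => x (p⁻¹ i) := by
  funext i
  rw [Matrix.mulVec, dotProduct]
  simp only [hM, ite_mul, one_mul, zero_mul]
  have : ∀ j, (p j = i) = (j = p⁻¹ i) := fun j => propext
    ⟨fun h => by rw [← h]; exact (Equiv.symm_apply_apply p j).symm,
     fun h => by rw [h]; exact Equiv.apply_symm_apply p i⟩
  simp only [this, Finset.sum_ite_eq', Finset.mem_univ, if_true]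

/-- A permutation matrix has unit column sums. [folklore] -/
theorem sum_of_perm {m : ℕ} (p : Equiv.Perm (Fin m)) (M : Matrix (Fin m) (Fin m) R)
    (hM : ∀ i j, M i j = if p j = i then 1 else 0) (k : Fin m) : ∑ j, M j k = 1 := by
  simp only [hM]
  rw [Finset.sum_ite_eq Finset.univ (p k) (fun _ => (1 : R)), if_pos (Finset.mem_univ _)]

end Hyp

/-! ### The hyperplane representation of a framed representation with unit column sums -/

section Rep

variable {G : Type u} [Group G] [TopologicalSpace G] [IsTopologicalGroup G]
  {A : Type v} [CommRing A] [TopologicalSpace A] [IsTopologicalRing A] {n : ℕ}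

open Literature.NumberTheory.GaloisRepresentations

/-- **The hyperplane representation.**  For a framed continuous representation
`Π : G →ₜ* GL_{n+1}(A)` all of whose matrices have unit column sums (e.g. a permutation
representation) there is a framed continuous representation of rank `n` with matrices
`H(Π g) = ((Π g) (j+1) (k+1) - (Π g) (j+1) 0)ⱼₖ`: the action of `Π` on the stable sum-zero
hyperplane in the basis `eₖ₊₁ - e₀`. [folklore] -/
theorem exists_hyperplaneRep (P : FramedRep G A (n + 1))
    (hP : ∀ g k, ∑ j, ((P g : GL (Fin (n + 1)) A) : Matrix (Fin (n + 1)) (Fin (n + 1)) A) j k = 1) :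
    ∃ ρ : FramedRep G A n, ∀ g, ((ρ g : GL (Fin n) A) : Matrix (Fin n) (Fin n) A) =
      Matrix.of fun j k : Fin n =>
        ((P g : GL (Fin (n + 1)) A) : Matrix (Fin (n + 1)) (Fin (n + 1)) A) j.succ k.succ -
          ((P g : GL (Fin (n + 1)) A) : Matrix (Fin (n + 1)) (Fin (n + 1)) A) j.succ 0 := by
  have hc : Continuous fun g : G =>
      ((P g : GL (Fin (n + 1)) A) : Matrix (Fin (n + 1)) (Fin (n + 1)) A) :=
    Units.continuous_val.comp P.continuous
  have hh : Continuous fun g : G => Matrix.of fun j k : Fin n =>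
      ((P g : GL (Fin (n + 1)) A) : Matrix (Fin (n + 1)) (Fin (n + 1)) A) j.succ k.succ -
        ((P g : GL (Fin (n + 1)) A) : Matrix (Fin (n + 1)) (Fin (n + 1)) A) j.succ 0 :=
    continuous_matrix fun j k => (hc.matrix_elem j.succ k.succ).sub (hc.matrix_elem j.succ 0)
  -- the matrices `H(P g)` as units, with inverse `H(P g⁻¹)`
  let F : G → GL (Fin n) A := fun g => Units.mk
    (Matrix.of fun j k : Fin n =>
      ((P g : GL (Fin (n + 1)) A) : Matrix (Fin (n + 1)) (Fin (n + 1)) A) j.succ k.succ -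
        ((P g : GL (Fin (n + 1)) A) : Matrix (Fin (n + 1)) (Fin (n + 1)) A) j.succ 0)
    (Matrix.of fun j k : Fin n =>
      ((P g⁻¹ : GL (Fin (n + 1)) A) : Matrix (Fin (n + 1)) (Fin (n + 1)) A) j.succ k.succ -
        ((P g⁻¹ : GL (Fin (n + 1)) A) : Matrix (Fin (n + 1)) (Fin (n + 1)) A) j.succ 0)
    (by rw [← hypMat_mul _ _ (hP g⁻¹), ← Units.val_mul, ← map_mul, mul_inv_cancel, map_one,
      Units.val_one, hypMat_one])
    (by rw [← hypMat_mul _ _ (hP g), ← Units.val_mul, ← map_mul, inv_mul_cancel, map_one,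
      Units.val_one, hypMat_one])
  have hF : ∀ g, ((F g : GL (Fin n) A) : Matrix (Fin n) (Fin n) A) = Matrix.of fun j k : Fin n =>
      ((P g : GL (Fin (n + 1)) A) : Matrix (Fin (n + 1)) (Fin (n + 1)) A) j.succ k.succ -
        ((P g : GL (Fin (n + 1)) A) : Matrix (Fin (n + 1)) (Fin (n + 1)) A) j.succ 0 :=
    fun g => rfl
  let f : G →* GL (Fin n) A :=
    { toFun := F
      map_one' := Units.ext (by rw [hF]; simp only [map_one, Units.val_one, hypMat_one])
      map_mul' := fun g h => Units.ext (by
        rw [Units.val_mul, hF, hF, hF, map_mul, Units.val_mul]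
        exact hypMat_mul _ _ (hP h)) }
  refine ⟨{ toMonoidHom := f
            continuous_toFun := Units.continuous_iff.2 ⟨hh, hh.comp continuous_inv⟩ },
    fun g => rfl⟩

end Rep

end Summit.Langlands.Langlands.Theorems.DedekindQuotient1951

end
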